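import Summits.CriticalPhenomena.SAWScalingLimit.Theorems.FKGToTraversalBound.Negative.DeepEndpointGap
import Summits.CriticalPhenomena.SAWScalingLimit.Theorems.SAWLoopFugacityFlowAssembly

/-!
# The carriers `dom C δ` of `LeftRightFKG` are bounded; finiteness of the chord weight
(crux `SAWLeftRightFKG.FKGToTraversalBound`, stmt-CriticalPhenomena-1878)

Line `excursion-domination` (lead), registered sub-goal `stub_domBounded`.

The hypothesis `LeftRightFKG` of the crux is typed on the carriers
`dom C δ = {z | wind(δ-polyline of the closed lattice walk C, z) ≠ 0}` (`Negative.DeepEndpointGap`).  Every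
positive-association line of the crux uses PA in the complement form `w(E ∩ D)·w(univ) ≤ w(E)·w(D)`
(`stub_carveCore`, landed in `SAWLeftRightFKGFKGToTraversalBoundCarveCore`), whose only structural hypothesis is
the finiteness of the total weight `SAW.weight (dom C δ) δ a b univ`.  This file discharges it:

* `wind_sub_eq_zero_of_norm_le` — a closed loop confined to the disc `‖w‖ ≤ R` does not wind about a point of
  norm `> R` (Rouché for loops against the constant loop `-z`, `wind_eq_of_norm_sub_lt` + `wind_const`);
* `stub_domBounded` — `dom C δ` is bounded: the polyline of `C` is compact, hence inside some disc `‖w‖ ≤ R`,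
  and `dom C δ ⊆ closedBall 0 R` by the previous item;
* `finite_domainSAW_dom`, `weight_dom_univ_ne_top` — for `δ > 0` the type of chords of `dom C δ` is finite
  (`SAWLoopFugacityFlowAssembly.finite_domainSAW`) and the total critical weight is finite
  (`SAWLoopFugacityFlowAssembly.weight_univ_ne_top`) — so `stub_carveCore` applies with its finiteness
  hypothesis discharged by `weight_dom_univ_ne_top C hδ a b` (the hypothesis-free corollary is to be appended
  once the farm serves the `CarveCore` module).

No named fact is used; axioms are the standard three.
-/

noncomputable section

open MeasureTheory Set Metric
open Literature.Probability.LatticeModels Literature.Probability.RandomPlanarGeometry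
open Literature.Topology.PlaneTopology
open Summit.CriticalPhenomena.SAWScalingLimit.Theses.SAWLeftRightFKG
open Summit.CriticalPhenomena.SAWScalingLimit.Theorems.FKGToTraversalBound.Negative (dom lrLE)

namespace Summit.CriticalPhenomena.SAWScalingLimit.Theorems.FKGToTraversalBound.ExcursionDomination

/-- **No winding about far points.**  A closed curve `γ` on `[0, 1]` confined to the closed disc `‖w‖ ≤ R`
does not wind about any point `z` with `‖z‖ > R`: the loop `γ - z` is within `‖γ‖ ≤ R < ‖z‖` of the constant
loop `-z`, so Rouché's principle for loops (`wind_eq_of_norm_sub_lt`) and `wind_const` give winding number `0`. -/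
theorem wind_sub_eq_zero_of_norm_le {γ : C(unitInterval, ℂ)} {R : ℝ} (hγ : ∀ s, ‖γ s‖ ≤ R)
    {z : ℂ} (hz : R < ‖z‖) (h01 : γ 0 = γ 1) :
    wind (fun t : ℝ => Set.IccExtend zero_le_one γ t - z) = 0 := by
  have hz0 : -z ≠ 0 := neg_ne_zero.2 (norm_pos_iff.1 (((norm_nonneg (γ 0)).trans (hγ 0)).trans_lt hz))
  rw [← wind_const (-z)]
  refine wind_eq_of_norm_sub_lt ((γ.continuous.Icc_extend').continuousOn.sub continuousOn_const) ?_
    (IsNonvanishingLoop.const hz0) fun t _ => ?_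
  · show Set.IccExtend zero_le_one γ 0 - z = Set.IccExtend zero_le_one γ 1 - z
    rw [Set.IccExtend_left, Set.IccExtend_right]
    exact congrArg (fun w => w - z) h01
  · rw [sub_neg_eq_add, sub_add_cancel, norm_neg]
    exact (hγ _).trans_lt hz

/-- **The carriers of `LeftRightFKG` are bounded** (registered sub-goal `stub_domBounded` of the crux
stmt-CriticalPhenomena-1878).  The mesh polyline of the closed lattice walk `C` is a continuous image of
`[0, 1]`, hence compact and contained in some disc `‖w‖ ≤ R`; a point outside that disc has winding number `0`
(`wind_sub_eq_zero_of_norm_le`), so `dom C δ = {z | wind ≠ 0} ⊆ closedBall 0 R`. -/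
theorem stub_domBounded : ∀ (c : Site 2) (C : (zdGraph 2).Walk c c) (δ : ℝ),
    Bornology.IsBounded (dom C δ) := by
  intro c C δ
  obtain ⟨R, hR⟩ :=
    (isCompact_range (C.toCurve (meshPoint δ)).continuous).isBounded.subset_closedBall (0 : ℂ)
  refine (isBounded_closedBall (x := (0 : ℂ)) (r := R)).subset fun z hz => ?_
  have hz' : wind (fun t : ℝ => Set.IccExtend zero_le_one (C.toCurve (meshPoint δ)) t - z) ≠ 0 := hz
  rw [mem_closedBall_zero_iff]
  by_contra hzR
  refine hz' (wind_sub_eq_zero_of_norm_le (fun s => mem_closedBall_zero_iff.1 (hR ⟨s, rfl⟩))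
    (not_le.1 hzR) ?_)
  rw [SimpleGraph.Walk.toCurve_apply_zero, SimpleGraph.Walk.toCurve_apply_one]

/-- For `δ > 0` there are finitely many chords of the carrier `dom C δ` between two given sites (the carrier
is bounded, `stub_domBounded`, so `(dom C δ)_δ` is a finite site set and chords are duplicate-free lists over
it, `SAWLoopFugacityFlowAssembly.finite_domainSAW`). -/
theorem finite_domainSAW_dom {c : Site 2} (C : (zdGraph 2).Walk c c) {δ : ℝ} (hδ : 0 < δ)
    (u v : Site 2) : Finite (SAW.DomainSAW (dom C δ) δ u v) :=
  SAWLoopFugacityFlowAssembly.finite_domainSAW (stub_domBounded c C δ) hδ u v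

/-- For `δ > 0` the total critical weight `Z = Σ_γ x_c^{|γ|}` of the chords of `dom C δ` between two given
sites is finite (finitely many chords, `finite_domainSAW_dom`).  This is the structural hypothesis of
`stub_carveCore` (`SAWLeftRightFKGFKGToTraversalBoundCarveCore`). -/
theorem weight_dom_univ_ne_top {c : Site 2} (C : (zdGraph 2).Walk c c) {δ : ℝ} (hδ : 0 < δ)
    (u v : Site 2) : SAW.weight (dom C δ) δ u v Set.univ ≠ ⊤ := by
  haveI := finite_domainSAW_dom C hδ u v
  exact SAWLoopFugacityFlowAssembly.weight_univ_ne_top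

end Summit.CriticalPhenomena.SAWScalingLimit.Theorems.FKGToTraversalBound.ExcursionDomination

end
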